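import Summits.QuantumFields.YangMills.Theorems.BalabanUVNodesK1V7RDefs
import Summits.QuantumFields.YangMills.Theorems.BalabanUVNodesN13Cor3MargDensityVersionNotDeterminedAtRecord13

/-!
# BalabanUVNodes ∕ K1 skeleton — LOCATED KERNEL CERTIFICATE: THE v7ᴿ ∕ «v8ʳᵉᶠˡ» RUNG PREDICATES INHERIT THE VERSION PIN — the conclusion TEXT of the registered stub `stub_runRows13PWS`
# (`K1V6Defs.RunRowsAtSomeRecord13PWS F`), hence of `stub_cont13` (`K1V7RDefs.RunRowsContAtSomeRecord13PWS F`), ALONE entails the non-vanishing AT ONE POINT of Mathlib's chosen marginal-density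
# version of record, together with an a.e.-equal version vanishing there; so do the three stub texts jointly from `Inhabited13 F`

Cell `pub-ymgap` (HUMAN RULING D-0062 Track A ∕ D-0149 width), WIDTH SEAT `pub-ymgap-dag-n13-w2` (gen 4, CLAIM-5, INBOX l.35693), key K1⁹ `StabilityBRunRowsAtRecordR13SepCoPHV` = stmt-QuantumFields-27364
(route rev 29, dag-lead KEY MAP v2 ∕ GATE v1.69; K1⁸ 26907 and K1⁷ 20542 now `aside`; op 5 registers the K1⁹ skeleton «v8ʳᵉᶠˡ» with the v7ᴿ stubs BYTE-IDENTICAL) (`--kind proof --supports … --as helper`; count-neutral; LOCATED reading for plan g85's D85-REV28 sheet ∕ CRIT-1 ∕ dag-lead — NO skeleton or route text changed or proposed here).  BY-NAME composition of: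
dag-n24-w1's `…K1EndOfNodes13PWSOfRunRemAt.stabilityB_body_of_rung1At_of_runLetters` (p598782 §2: a rung-2″ witness ⟹ (B) ∧ the `K ≥ 1` window at the UNREVISED datum of record), dag-n13-w1's
`…N13Cor3PinsMargDensityVersionAtRecord13.exists_avgDensity_ne_zero_of_endStatementBPrinted_of_window` (p610399: (B) ∧ window ⟹ the pin), this seat's
`…N13Cor3MargDensityVersionNotDeterminedAtRecord13.exists_version_ae_eq_avgDensity_eq_zero` (p617654: a version `=ᵐ` the pinned one vanishing at the pinned point), and the rung predicates
`K1V6Defs.{Inhabited13, NodesAtSomeRecord13PWS, RunRowsAtSomeRecord13PWS}` ∕ `K1V7RDefs.RunRowsContAtSomeRecord13PWS` (the registered stub texts BY NAME).  [III] = [Balaban1988Convergent],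
[B16] = [Balaban1989LargeFieldII], [I] = [Balaban1987RG1].

WHY (plan g85 SHAPE SHEET REV28, INBOX l.35472: «K1 v8ʳᵉᶠˡ: v7ᴿ's three stubs BYTE-IDENTICAL, composition through the door `Revision₁₃.refl`; honest: slot used trivially»).  The rung predicates key the
witness world to the UNREVISED datum (`RecordS`: `w.C = (datumOfRecord₁₃SepCoPH F 2 θ h).C`) and carry N13's node inside `∀ P, Nodes (leavesP w P)`; rung 2″ adds the run rows, whence the window.  THIS FILE:
the TEXT `RunRowsAtSomeRecord13PWS F` by itself yields (B) ∧ window at the unrevised datum (§1), hence the pin (§2) — so whatever door composes them, a skeleton keeping these rung texts has a chain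
output that no `dV`-a.e.-invariant knowledge of the version (i.e. no estimate on Bałaban's objects; p617654) can deliver.  Where the (δⱽ) slot's teeth must enter is therefore the RUNG PREDICATES
(`RecordS` at `datumOfRecord₁₃SepCoPHⱽ θ h v`, `v` ∃-side — N13's node there being supplied by the a.e. chain p623210 → p621421 → DEF-1 p620607); the planners' word.

WHAT THIS FILE PROVES (theorems only; 0 `def`; no `instance`, no `notation`; standard axioms).
§1 `endStatementBPrinted_window_of_runRowsAtSomeRecord13PWS` — `RunRowsAtSomeRecord13PWS F → ∃ θ h, Admissible ∧ (B)(datumOfRecord₁₃SepCoPH θ h) ∧ Window` (p598782 BY NAME).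
§2 ★★★ `pin_and_nonDetermination_of_runRowsAtSomeRecord13PWS` — `RunRowsAtSomeRecord13PWS F → ∃ θ P, 1 ≤ P.K ∧ avgDensity (avOfRecord F 2 P.K 0).avg V₁ ≠ 0 ∧ ∃ h₀ (measurable, same defining identity,
   `=ᵐ[dV]` that version), h₀ V₁ = 0`, `V₁ := critCfgOfRecord θ.ν P.K 1 1`; ★ `…_of_runRowsContAtSomeRecord13PWS` (stub 3's text); ★★ `…_of_stubTexts` (`stub_nodes13PWS` ∧ `stub_runRows13PWS` texts
   + `Inhabited13 F`) and `…_of_stubTexts3` (+ `stub_cont13`'s text).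

HONEST FRAMING.  Count-neutral by-name composition; nothing of Bałaban's asserted or refuted; NO stub proved or refuted (these are implications FROM the stub TEXTS' conclusions); K1⁸ NEITHER proved NOR
refuted (the K1⁹ item TEXT `∃ v, (B)(datumOfRecord₁₃SepCoPHⱽ … v)` is the repaired display and is NOT claimed to inherit the pin — only the byte-identical RUNG PREDICATES are); no skeleton ∕ route text changed
or proposed; N13 NOT discharged; counts unmoved (typed 28∕28 · discharged 5∕28 · A 5∕28); one finite `𝕋⁴_{L^K}` programme at fixed `ε = L^{−K}`, Bałaban AS
PRINTED; route R4 closes the CONDITIONAL finite-𝕋⁴ rung `BalabanLadder.UV` only — the Yang–Mills mass gap (Clay) is NOT proved by any of this; nothing continuum ∕ ℝ⁴ ∕ OS.  No `sorry`.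

EDITION v1.0.1 (DOC-ONLY; every declaration byte-identical to v1.0 p624941).  Folds dag-ref-M g10 READ-136a NIT («5∕27», INBOX l.40607): the count phrase «discharged 5∕27» was a typo for «5∕28»
(28 typed nodes); the desk's kernel finding T1 (the ★★★ output pins a `dV₁`-NULL point — `fieldMeasure … {V₁} = 0` — i.e. exactly the non-determination this header names) is a fact for the planners, not a
defect, and is acknowledged here without change.  Nothing mathematical changed; counts UNMOVED.
-/

noncomputable section

open scoped ENNReal NNReal Matrix.Norms.L2Operator

namespace Summit.QuantumFields.YangMills.BalabanUVNodes.K1StubTextsInheritVersionPinAtRecord13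

open MeasureTheory
open Literature.MathematicalPhysics.QuantumFieldTheory.Balaban1983to89
open Literature.MathematicalPhysics.QuantumFieldTheory.Balaban1983to89.T4Continuum
open Literature.MathematicalPhysics.QuantumFieldTheory.Balaban1983to89.Node00
open T4AveragingDisintegration (avgDensity)
open Summit.QuantumFields.YangMills.Theorems.K1V6Defs (Inhabited13 NodesAtSomeRecord13PWS RunRowsAtSomeRecord13PWS)
open Summit.QuantumFields.YangMills.Theorems.K1V7RDefs (RunRowsContAtSomeRecord13PWS runRowsAtSomeRecord13PWS_of_runRowsContAtSomeRecord13PWS)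
open Summit.QuantumFields.YangMills.BalabanUVNodes.K1EndOfNodes13PWSOfRunRemAt (stabilityB_body_of_rung1At_of_runLetters)
open Summit.QuantumFields.YangMills.BalabanUVNodes.N13Cor3PinsMargDensityVersionAtRecord13 (exists_avgDensity_ne_zero_of_endStatementBPrinted_of_window)
open Summit.QuantumFields.YangMills.BalabanUVNodes.N13Cor3MargDensityVersionNotDeterminedAtRecord13 (exists_version_ae_eq_avgDensity_eq_zero)

variable {F : T4Family}

/-! ## §1 The rung-2″ TEXT yields (B) ∧ the `K ≥ 1` window at the UNREVISED datum -/

/-- **The conclusion text of `stub_runRows13PWS` yields (B) and the window at the unrevised datum of record** (dag-n24-w1's `stabilityB_body_of_rung1At_of_runLetters`, p598782, BY NAME).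
[cite: Balaban1989LargeFieldII, Thm 1 p.355, (0.1) pp.355–356; Balaban1987RG1, Thm 3 p.264, (5.10) p.293; Balaban1988Convergent, Cor. 3 (2.50) p.264 (bookkeeping)] -/
theorem endStatementBPrinted_window_of_runRowsAtSomeRecord13PWS (hrows : RunRowsAtSomeRecord13PWS F) :
    ∃ (θ : Stage13HParams F 2) (h : θ.Provisos₁₃SepCoPH F 2), θ.Admissible F 2 ∧ B16.EndStatementBPrinted (datumOfRecord₁₃SepCoPH F 2 θ h).C ∧
      ∃ γ₁ : ℝ, 0 < γ₁ ∧ ∀ γ : ℝ, 0 < γ → γ ≤ γ₁ → ∃ P : B12.RunParams, 1 ≤ P.K ∧ ((datumOfRecord₁₃SepCoPH F 2 θ h).C P).flow.InInterval γ P.K := by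
  obtain ⟨θ, h, w, hU, hθ, hR, hnodes, b, r, γ₀, B, M, hγ₀, hrem, hB, hmatch, hps⟩ := hrows
  obtain ⟨-, hθ', hb, hW⟩ := stabilityB_body_of_rung1At_of_runLetters θ h w hU hθ hR hnodes hγ₀ hrem hB hmatch hps
  exact ⟨θ, h, hθ', hb, hW⟩

/-! ## §2 … hence the version PIN, with its non-determination alongside -/

/-- **★★★ THE RUNG-2″ TEXT INHERITS THE PIN**: `K1V6Defs.RunRowsAtSomeRecord13PWS F` (the conclusion of the registered stub `stub_runRows13PWS`, v6 = v7ᴿ = «v8ʳᵉᶠˡ» VERBATIM) ⟹ some `θ` and a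
windowed run `P` (`K ≥ 1`) with `avgDensity (avOfRecord F 2 P.K 0).avg V₁ ≠ 0` at `V₁ := critCfgOfRecord θ.ν P.K 1 1` — a point value of Mathlib's chosen `rnDeriv` version (p610399) — AND a version `h₀`, measurable,
with the same defining identity `dV₁.withDensity ↑h₀ = (dU₀).map Ū`, `h₀ =ᵐ[dV₁]` that version, VANISHING at `V₁` (p617654).  An implication FROM the text; no stub proved or refuted.
[cite: Balaban1989LargeFieldII, Thm 1 p.355, (0.1) pp.355–356; Balaban1988Convergent, Cor. 3 (2.50) p.264; Balaban1987RG1, (0.4) p.253, (2.9) p.266, Thm 3 p.264 (bookkeeping)] -/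
theorem pin_and_nonDetermination_of_runRowsAtSomeRecord13PWS (hrows : RunRowsAtSomeRecord13PWS F) :
    ∃ (θ : Stage13HParams F 2) (P : B12.RunParams), 1 ≤ P.K ∧
      avgDensity (avOfRecord F 2 P.K 0).avg (critCfgOfRecord F 2 θ.ν P.K 1 1) ≠ 0 ∧
      ∃ h₀ : GaugeField (F.P P.K) 1 (SU 2) → ℝ≥0, Measurable h₀ ∧
        (fieldMeasure (F.P P.K) 1 (SU 2)).withDensity (fun V => (h₀ V : ℝ≥0∞)) = (fieldMeasure (F.P P.K) 0 (SU 2)).map (avOfRecord F 2 P.K 0).avg ∧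
        h₀ =ᵐ[fieldMeasure (F.P P.K) 1 (SU 2)] avgDensity (avOfRecord F 2 P.K 0).avg ∧ h₀ (critCfgOfRecord F 2 θ.ν P.K 1 1) = 0 := by
  obtain ⟨θ, h, hθ, hb, hW⟩ := endStatementBPrinted_window_of_runRowsAtSomeRecord13PWS hrows
  obtain ⟨P, hK, hne⟩ := exists_avgDensity_ne_zero_of_endStatementBPrinted_of_window θ h hθ.ε₂₉_pos hb hW
  exact ⟨θ, P, hK, hne, exists_version_ae_eq_avgDensity_eq_zero F P.K 0 hK _⟩

/-- **★ THE RUNG-2‴ TEXT (`stub_cont13`'s conclusion, `K1V7RDefs.RunRowsContAtSomeRecord13PWS F`) INHERITS THE PIN** (it extends rung 2″). [cite: Balaban1987RG1, Thm 3 p.264, §1 pp.263–264; Balaban1988Convergent, Cor. 3 (2.50) p.264 (bookkeeping)] -/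
theorem pin_and_nonDetermination_of_runRowsContAtSomeRecord13PWS (hrows : RunRowsContAtSomeRecord13PWS F) :
    ∃ (θ : Stage13HParams F 2) (P : B12.RunParams), 1 ≤ P.K ∧
      avgDensity (avOfRecord F 2 P.K 0).avg (critCfgOfRecord F 2 θ.ν P.K 1 1) ≠ 0 ∧
      ∃ h₀ : GaugeField (F.P P.K) 1 (SU 2) → ℝ≥0, Measurable h₀ ∧
        (fieldMeasure (F.P P.K) 1 (SU 2)).withDensity (fun V => (h₀ V : ℝ≥0∞)) = (fieldMeasure (F.P P.K) 0 (SU 2)).map (avOfRecord F 2 P.K 0).avg ∧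
        h₀ =ᵐ[fieldMeasure (F.P P.K) 1 (SU 2)] avgDensity (avOfRecord F 2 P.K 0).avg ∧ h₀ (critCfgOfRecord F 2 θ.ν P.K 1 1) = 0 :=
  pin_and_nonDetermination_of_runRowsAtSomeRecord13PWS (runRowsAtSomeRecord13PWS_of_runRowsContAtSomeRecord13PWS F hrows)

/-- **★★ THE v6∕v7ᴿ STUB TEXTS `stub_nodes13PWS` ∧ `stub_runRows13PWS` JOINTLY INHERIT THE PIN at every family with K0⁷'s conclusion** (`Inhabited13 F`). [cite: Balaban1989LargeFieldII, Thm 1 p.355; Balaban1988Convergent, Cor. 3 (2.50) p.264; Balaban1987RG1, Thm 3 p.264 (bookkeeping)] -/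
theorem pin_and_nonDetermination_of_stubTexts
    (h₁ : ∀ F : T4Family, Inhabited13 F → NodesAtSomeRecord13PWS F) (h₂ : ∀ F : T4Family, NodesAtSomeRecord13PWS F → RunRowsAtSomeRecord13PWS F)
    (F : T4Family) (hF : Inhabited13 F) :
    ∃ (θ : Stage13HParams F 2) (P : B12.RunParams), 1 ≤ P.K ∧
      avgDensity (avOfRecord F 2 P.K 0).avg (critCfgOfRecord F 2 θ.ν P.K 1 1) ≠ 0 ∧
      ∃ h₀ : GaugeField (F.P P.K) 1 (SU 2) → ℝ≥0, Measurable h₀ ∧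
        (fieldMeasure (F.P P.K) 1 (SU 2)).withDensity (fun V => (h₀ V : ℝ≥0∞)) = (fieldMeasure (F.P P.K) 0 (SU 2)).map (avOfRecord F 2 P.K 0).avg ∧
        h₀ =ᵐ[fieldMeasure (F.P P.K) 1 (SU 2)] avgDensity (avOfRecord F 2 P.K 0).avg ∧ h₀ (critCfgOfRecord F 2 θ.ν P.K 1 1) = 0 :=
  pin_and_nonDetermination_of_runRowsAtSomeRecord13PWS (h₂ F (h₁ F hF))

/-- **… and so do the THREE v7ᴿ = «v8ʳᵉᶠˡ» stub texts** (`stub_cont13`'s hypothesis is rung 2″'s text; its conclusion extends it). [cite: Balaban1987RG1, Thm 3 p.264, §1 pp.263–264 (bookkeeping)] -/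
theorem pin_and_nonDetermination_of_stubTexts3
    (h₁ : ∀ F : T4Family, Inhabited13 F → NodesAtSomeRecord13PWS F) (h₂ : ∀ F : T4Family, NodesAtSomeRecord13PWS F → RunRowsAtSomeRecord13PWS F)
    (h₃ : ∀ F : T4Family, RunRowsAtSomeRecord13PWS F → RunRowsContAtSomeRecord13PWS F) (F : T4Family) (hF : Inhabited13 F) :
    ∃ (θ : Stage13HParams F 2) (P : B12.RunParams), 1 ≤ P.K ∧
      avgDensity (avOfRecord F 2 P.K 0).avg (critCfgOfRecord F 2 θ.ν P.K 1 1) ≠ 0 ∧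
      ∃ h₀ : GaugeField (F.P P.K) 1 (SU 2) → ℝ≥0, Measurable h₀ ∧
        (fieldMeasure (F.P P.K) 1 (SU 2)).withDensity (fun V => (h₀ V : ℝ≥0∞)) = (fieldMeasure (F.P P.K) 0 (SU 2)).map (avOfRecord F 2 P.K 0).avg ∧
        h₀ =ᵐ[fieldMeasure (F.P P.K) 1 (SU 2)] avgDensity (avOfRecord F 2 P.K 0).avg ∧ h₀ (critCfgOfRecord F 2 θ.ν P.K 1 1) = 0 :=
  pin_and_nonDetermination_of_runRowsContAtSomeRecord13PWS (h₃ F (h₂ F (h₁ F hF)))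

end Summit.QuantumFields.YangMills.BalabanUVNodes.K1StubTextsInheritVersionPinAtRecord13

end
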